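import Mathlib.Data.Real.Basic
import Mathlib.Data.List.GetD
import Mathlib.Tactic
import HarnessLib

/-!
# Crux `BoundaryTP2` (stmt-CriticalPhenomena-7115): exact-arithmetic subdivision certificate for TP₂ inequalities

Certified-compute seat (refuter, `ccert`), part 1 of the circular-TP₂ certificate kit (part 2:
`TP2CertKit.lean`, instances `TP2CertBox…`).  Pure arithmetic, no SAWs: polynomials with natural
coefficients as coefficient lists (`evPoly`, Horner), their homogenised exact evaluation in `ℕ`
(`hornerH`, `hornerH_eq`), the dyadic cells of the fugacity interval `[10/27, 5/13] = [130/351, 135/351]`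
(`⊇ [1/2.7, 1/2.6]`, the proved enclosure of `x_c = 1/μ`), the one-cell test "crossing product at the right
end ≤ non-crossing product at the left end" (`cellOK`, sound by monotonicity: `cellOK_sound`), its adaptive
subdivision (`certRec`, `certRec_sound`), and the all-quadruples certificate over a table of coefficient
vectors indexed by pairs `i < j` (`rowsOf`, `cf`, `certAll`, `poly_of_certAll`).  Everything proved. [folklore]
-/

namespace Summit.CriticalPhenomena.SAWScalingLimit.Theorems.BoundaryTP2.Negative.Cert

/-! ## §1 Coefficient-list polynomials, Horner evaluation, homogenisation -/

/-- Horner evaluation of a coefficient list: `evPoly [c₀,c₁,…] x = c₀ + x (c₁ + x (…))`. [folklore] -/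
noncomputable def evPoly : List ℕ → ℝ → ℝ
  | [], _ => 0
  | c :: cs, x => c + x * evPoly cs x

/-- Evaluation of the empty list. [folklore] -/
@[simp] theorem evPoly_nil (x : ℝ) : evPoly [] x = 0 := rfl

/-- Horner step. [folklore] -/
@[simp] theorem evPoly_cons (c : ℕ) (cs : List ℕ) (x : ℝ) : evPoly (c :: cs) x = c + x * evPoly cs x := rfl

/-- Non-negativity on `x ≥ 0`. [folklore] -/
theorem evPoly_nonneg (c : List ℕ) {x : ℝ} (hx : 0 ≤ x) : 0 ≤ evPoly c x := by
  induction c with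
  | nil => simp
  | cons a cs ih => exact add_nonneg (Nat.cast_nonneg a) (mul_nonneg hx ih)

/-- Monotonicity on `x ≥ 0`. [folklore] -/
theorem evPoly_mono (c : List ℕ) {x y : ℝ} (hx : 0 ≤ x) (hxy : x ≤ y) : evPoly c x ≤ evPoly c y := by
  induction c with
  | nil => simp
  | cons a cs ih =>
    simp only [evPoly_cons]
    exact add_le_add le_rfl (mul_le_mul hxy ih (evPoly_nonneg cs hx) (hx.trans hxy))

/-- Homogenised Horner evaluation in `ℕ`: `hornerH K c A D = D^K · evPoly c (A/D)` whenever
`c.length ≤ K + 1` (`hornerH_eq`). [folklore] -/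
def hornerH : ℕ → List ℕ → ℕ → ℕ → ℕ
  | _, [], _, _ => 0
  | K, c :: cs, A, D => c * D ^ K + A * hornerH (K - 1) cs A D

/-- The homogenisation identity. [folklore] -/
theorem hornerH_eq (c : List ℕ) : ∀ (K : ℕ) (A D : ℕ), (D : ℝ) ≠ 0 → c.length ≤ K + 1 →
    (hornerH K c A D : ℝ) = (D : ℝ) ^ K * evPoly c ((A : ℝ) / D) := by
  induction c with
  | nil => intro K A D _ _; simp [hornerH]
  | cons a cs ih =>
    intro K A D hD hlen
    cases cs with
    | nil => simp [hornerH, evPoly]; ring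
    | cons a' cs' =>
      obtain ⟨K', rfl⟩ : ∃ K', K = K' + 1 := ⟨K - 1, by simp at hlen; omega⟩
      have h := ih K' A D hD (by simp at hlen ⊢; omega)
      rw [hornerH.eq_2, Nat.add_sub_cancel]
      push_cast
      rw [h]
      simp only [evPoly_cons, pow_succ]
      field_simp

/-! ## §2 Dyadic cells of `[10/27, 5/13] = [130/351, 135/351]` and the one-cell test -/

/-- Numerator of the left end of cell `m` at depth `d`: `130·2^d + 5m`. [folklore] -/
def numL (d m : ℕ) : ℕ := 130 * 2 ^ d + 5 * m

/-- Common denominator at depth `d`: `351·2^d`. [folklore] -/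
def den (d : ℕ) : ℕ := 351 * 2 ^ d

/-- The grid point `t_{d,m} = (130·2^d + 5m)/(351·2^d)`. [folklore] -/
noncomputable def tR (d m : ℕ) : ℝ := (numL d m : ℝ) / (den d : ℝ)

/-- The denominator is positive. [folklore] -/
theorem den_pos (d : ℕ) : (0 : ℝ) < den d := by
  simp only [den, Nat.cast_mul, Nat.cast_pow, Nat.cast_ofNat]; positivity

/-- Grid points are non-negative. [folklore] -/
theorem tR_nonneg (d m : ℕ) : 0 ≤ tR d m := div_nonneg (Nat.cast_nonneg _) (den_pos d).le

/-- The left end of the interval: `130/351 = 10/27`. [folklore] -/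
theorem tR_zero_zero : tR 0 0 = 10 / 27 := by norm_num [tR, numL, den]

/-- The right end of the interval: `135/351 = 5/13`. [folklore] -/
theorem tR_zero_one : tR 0 1 = 5 / 13 := by norm_num [tR, numL, den]

/-- Refinement: the left end is inherited. [folklore] -/
theorem tR_succ_double (d m : ℕ) : tR (d + 1) (2 * m) = tR d m := by
  unfold tR
  rw [div_eq_div_iff (den_pos _).ne' (den_pos _).ne']
  simp only [numL, den]
  push_cast
  ring

/-- Refinement: the right end is inherited. [folklore] -/
theorem tR_succ_double_succ (d m : ℕ) : tR (d + 1) (2 * m + 1 + 1) = tR d (m + 1) := by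
  rw [show 2 * m + 1 + 1 = 2 * (m + 1) by ring, tR_succ_double]

/-- One cell: crossing product at the right end ≤ non-crossing product at the left end, in exact `ℕ`
arithmetic (`A`,`B` non-crossing pair, `C`,`D` crossing pair). [folklore] -/
def cellOK (K : ℕ) (A B C D : List ℕ) (d m : ℕ) : Bool :=
  Nat.ble (hornerH K C (numL d (m + 1)) (den d) * hornerH K D (numL d (m + 1)) (den d))
    (hornerH K A (numL d m) (den d) * hornerH K B (numL d m) (den d))

/-- Soundness of the one-cell test. [folklore] -/
theorem cellOK_sound {K : ℕ} {A B C D : List ℕ} (hA : A.length ≤ K + 1) (hB : B.length ≤ K + 1)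
    (hC : C.length ≤ K + 1) (hD : D.length ≤ K + 1) {d m : ℕ} (h : cellOK K A B C D d m = true)
    {x : ℝ} (h1 : tR d m ≤ x) (h2 : x ≤ tR d (m + 1)) :
    evPoly C x * evPoly D x ≤ evPoly A x * evPoly B x := by
  have hx : 0 ≤ x := (tR_nonneg d m).trans h1
  have hDen : ((den d : ℕ) : ℝ) ≠ 0 := (den_pos d).ne'
  have hpow : (0 : ℝ) < ((den d : ℕ) : ℝ) ^ K := pow_pos (den_pos d) K
  rw [cellOK, Nat.ble_eq] at h
  have hR : ((hornerH K C (numL d (m + 1)) (den d) : ℕ) : ℝ) * (hornerH K D (numL d (m + 1)) (den d) : ℕ) ≤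
      ((hornerH K A (numL d m) (den d) : ℕ) : ℝ) * (hornerH K B (numL d m) (den d) : ℕ) := by
    exact_mod_cast h
  rw [hornerH_eq C K _ _ hDen hC, hornerH_eq D K _ _ hDen hD, hornerH_eq A K _ _ hDen hA,
    hornerH_eq B K _ _ hDen hB] at hR
  have key : evPoly C (tR d (m + 1)) * evPoly D (tR d (m + 1)) ≤ evPoly A (tR d m) * evPoly B (tR d m) := by
    have hR' : ((den d : ℕ) : ℝ) ^ K * ((den d : ℕ) : ℝ) ^ K *
        (evPoly C (tR d (m + 1)) * evPoly D (tR d (m + 1))) ≤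
        ((den d : ℕ) : ℝ) ^ K * ((den d : ℕ) : ℝ) ^ K * (evPoly A (tR d m) * evPoly B (tR d m)) := by
      simp only [tR]; linarith [hR]
    exact le_of_mul_le_mul_left hR' (mul_pos hpow hpow)
  have hx1 : 0 ≤ tR d (m + 1) := tR_nonneg _ _
  calc evPoly C x * evPoly D x
      ≤ evPoly C (tR d (m + 1)) * evPoly D (tR d (m + 1)) :=
        mul_le_mul (evPoly_mono C hx h2) (evPoly_mono D hx h2) (evPoly_nonneg D hx) (evPoly_nonneg C hx1)
    _ ≤ evPoly A (tR d m) * evPoly B (tR d m) := key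
    _ ≤ evPoly A x * evPoly B x :=
        mul_le_mul (evPoly_mono A (tR_nonneg d m) h1) (evPoly_mono B (tR_nonneg d m) h1)
          (evPoly_nonneg B (tR_nonneg d m)) (evPoly_nonneg A hx)

/-- Adaptive dyadic subdivision with fuel. [folklore] -/
def certRec (K : ℕ) (A B C D : List ℕ) : ℕ → ℕ → ℕ → Bool
  | 0, d, m => cellOK K A B C D d m
  | f + 1, d, m => cellOK K A B C D d m ||
      (certRec K A B C D f (d + 1) (2 * m) && certRec K A B C D f (d + 1) (2 * m + 1))

/-- Consecutive grid points are ordered. [folklore] -/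
theorem tR_mono_succ (d m : ℕ) : tR d m ≤ tR d (m + 1) := by
  unfold tR
  refine div_le_div_of_nonneg_right ?_ (den_pos d).le
  exact_mod_cast (show numL d m ≤ numL d (m + 1) by unfold numL; omega)

/-- **Soundness of the subdivision certificate**: on the whole cell `[t_{d,m}, t_{d,m+1}]` the crossing
product `C·D` is at most the non-crossing product `A·B`. [folklore] -/
theorem certRec_sound {K : ℕ} {A B C D : List ℕ} (hA : A.length ≤ K + 1) (hB : B.length ≤ K + 1)
    (hC : C.length ≤ K + 1) (hD : D.length ≤ K + 1) :
    ∀ (f d m : ℕ), certRec K A B C D f d m = true →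
      ∀ {x : ℝ}, tR d m ≤ x → x ≤ tR d (m + 1) → evPoly C x * evPoly D x ≤ evPoly A x * evPoly B x := by
  intro f
  induction f with
  | zero => intro d m h x h1 h2; exact cellOK_sound hA hB hC hD h h1 h2
  | succ f ih =>
    intro d m h x h1 h2
    simp only [certRec, Bool.or_eq_true, Bool.and_eq_true] at h
    rcases h with h | ⟨hl, hr⟩
    · exact cellOK_sound hA hB hC hD h h1 h2
    · rcases le_total x (tR (d + 1) (2 * m + 1)) with hx | hx
      · exact ih (d + 1) (2 * m) hl (by rwa [tR_succ_double]) hx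
      · exact ih (d + 1) (2 * m + 1) hr hx (by rwa [tR_succ_double_succ])

/-! ## §3 Tables indexed by pairs `i < j` of a list, and the all-quadruples certificate -/

/-- Rows of pairs: row `i` lists `(lᵢ, lⱼ)` for `j > i`. [folklore] -/
def rowsOf {α : Type*} : List α → List (List (α × α))
  | [] => []
  | u :: us => (us.map fun v => (u, v)) :: rowsOf us

/-- One row per list element. [folklore] -/
theorem length_rowsOf {α : Type*} (l : List α) : (rowsOf l).length = l.length := by
  induction l with
  | nil => rfl
  | cons u us ih => simp [rowsOf, ih]

/-- Entry `t` of row `i` is the pair `(lᵢ, l_{i+1+t})`; row `i` has `|l| - i - 1` entries. [folklore] -/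
theorem rowsOf_getD {α : Type*} (d : α) :
    ∀ (l : List α) (i t : ℕ), i + 1 + t < l.length →
      ((rowsOf l).getD i []).getD t (d, d) = (l.getD i d, l.getD (i + 1 + t) d) ∧
      ((rowsOf l).getD i []).length = l.length - i - 1 := by
  intro l
  induction l with
  | nil => intro i t h; simp at h
  | cons u us ih =>
    intro i t h
    cases i with
    | zero =>
      simp only [rowsOf, List.getD_cons_zero, List.length_cons, List.length_map]
      simp only [List.length_cons] at h
      refine ⟨?_, by omega⟩
      have ht : t < us.length := by omega
      rw [show (0 + 1 + t : ℕ) = t + 1 by omega, List.getD_cons_succ,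
        List.getD_eq_getElem _ _ (by simpa using ht), List.getElem_map, List.getD_eq_getElem _ _ ht]
    | succ i =>
      simp only [rowsOf, List.getD_cons_succ, List.length_cons]
      simp only [List.length_cons] at h
      obtain ⟨h1, h2⟩ := ih i t (by omega)
      refine ⟨?_, by omega⟩
      rw [h1, show i + 1 + 1 + t = (i + 1 + t) + 1 by omega, List.getD_cons_succ]

/-- Table lookup of the pair `(i, j)`, `i < j`. [folklore] -/
def cf (ctab : List (List (List ℕ))) (i j : ℕ) : List ℕ := (ctab.getD i []).getD (j - i - 1) []

/-- All table entries have length `≤ K + 1`. [folklore] -/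
def lenOK (K : ℕ) (ctab : List (List (List ℕ))) : Bool :=
  ctab.all fun row => row.all fun c => decide (c.length ≤ K + 1)

/-- Table entries (and the default) have length `≤ K + 1`. [folklore] -/
theorem length_cf_le {K : ℕ} {ctab : List (List (List ℕ))} (h : lenOK K ctab = true) (i j : ℕ) :
    (cf ctab i j).length ≤ K + 1 := by
  unfold cf
  rcases lt_or_ge i ctab.length with hi | hi
  · rw [List.getD_eq_getElem _ _ hi]
    rcases lt_or_ge (j - i - 1) (ctab[i]).length with hj | hj
    · rw [List.getD_eq_getElem _ _ hj]
      simp only [lenOK, List.all_eq_true, decide_eq_true_eq] at h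
      exact h _ (List.getElem_mem hi) _ (List.getElem_mem hj)
    · rw [List.getD_eq_default _ _ hj]; simp
  · rw [List.getD_eq_default _ _ hi]; simp

/-- Both non-crossing pairings dominate the crossing one, for the quadruple of indices `i<j<k<l`. [folklore] -/
def quadOK (K F : ℕ) (ctab : List (List (List ℕ))) (i j k l : ℕ) : Bool :=
  certRec K (cf ctab i j) (cf ctab k l) (cf ctab i k) (cf ctab j l) F 0 0 &&
    certRec K (cf ctab i l) (cf ctab j k) (cf ctab i k) (cf ctab j l) F 0 0

/-- **The certificate**: table lengths and all `C(m,4)` quadruples. [folklore] -/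
def certAll (m K F : ℕ) (ctab : List (List (List ℕ))) : Bool :=
  lenOK K ctab && (List.range m).all fun l => (List.range l).all fun k =>
    (List.range k).all fun j => (List.range j).all fun i => quadOK K F ctab i j k l

/-- Soundness of `certAll` at the level of coefficient vectors. [folklore] -/
theorem poly_of_certAll {m K F : ℕ} {ctab : List (List (List ℕ))} (h : certAll m K F ctab = true)
    {i j k l : ℕ} (hij : i < j) (hjk : j < k) (hkl : k < l) (hl : l < m) {x : ℝ}
    (hlo : 10 / 27 ≤ x) (hhi : x ≤ 5 / 13) :
    evPoly (cf ctab i k) x * evPoly (cf ctab j l) x ≤ evPoly (cf ctab i j) x * evPoly (cf ctab k l) x ∧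
    evPoly (cf ctab i k) x * evPoly (cf ctab j l) x ≤ evPoly (cf ctab i l) x * evPoly (cf ctab j k) x := by
  simp only [certAll, Bool.and_eq_true, List.all_eq_true, List.mem_range] at h
  obtain ⟨hlen, hall⟩ := h
  have hq := hall l hl k hkl j hjk i hij
  simp only [quadOK, Bool.and_eq_true] at hq
  have h1 : tR 0 0 ≤ x := by rw [tR_zero_zero]; exact hlo
  have h2 : x ≤ tR 0 (0 + 1) := by rw [zero_add, tR_zero_one]; exact hhi
  have hL := fun i j => length_cf_le hlen i j
  exact ⟨certRec_sound (hL i j) (hL k l) (hL i k) (hL j l) F 0 0 hq.1 h1 h2,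
    certRec_sound (hL i l) (hL j k) (hL i k) (hL j l) F 0 0 hq.2 h1 h2⟩

end Summit.CriticalPhenomena.SAWScalingLimit.Theorems.BoundaryTP2.Negative.Cert
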